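import Literature.AlgebraicGeometry.Resolution.QuadraticTransformsRegular
import Literature.AlgebraicGeometry.Resolution.RankOneReductionProofs
import Mathlib.RingTheory.IntegralClosure.IntegrallyClosed
import Mathlib.RingTheory.Localization.FractionRing
import HarnessLib

/-!
# Crux `Steer` (stmt-16345), chain W4.1 — R1/R2 exits: RADICAND EXCHANGE (idea-2 card
# `foliation-log-final-exit`, lemma L1; CHAIN v4.4 §D(a), first piece)

OURS (campaign `res-hironaka`, rung L, slot W4.1; helper for the frontier stubs `stub_core4LowMult(Odd)` /
`stub_core4EternalNonIsolated` of line `switching_dichotomy` (lead res-L0-w41-lead-1, r10/r11); replaces the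
role of no printed item; NOT a statement of the manuscript under review; AI-produced). Theses-free (the
skeleton's `Concl O A₀ t` is INLINED: `∃ A ⊇ A₀` finitely generated inside `O`, `t ∈ A`, `Frac A = K`,
regular at the centre of `O`).

* `isFractionRing_locAtCentre`; `radicandExchange` — **if SOME finitely generated `A ⊇ A₀` inside `O` with `Frac A = K` is regular at the
  centre of `O`, and `t ^ p ∈ A₀` (`0 < p`), then there is such an `A` containing `t`**: `t` is integral over
  the regular — hence normal — local ring `(A)_{𝔪_O ∩ A} ⊆ K` (`isIntegrallyClosedIn_of_isRegularLocalRing`),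
  so `t = a/s` with `v s = 1`, and `A[t] ⊆ (A)_{𝔪_O ∩ A}` has the same local ring at the centre
  (`locAtCentre_locAtCentre`). Consequence (idea-2's reading): every exit of an R1/R2 line may be run for
  ANY radicand `t₂` of the torsor, not only for the translates of `t` — `radicandExchange'` is the form
  `Concl O A₀ t₂ → Concl O A₀ t` of the card (`Sketch-idea-2b.lean`, `RadicandExchange p`).

Sources: folklore (normality of regular local rings: H. Matsumura, *Commutative Ring Theory*, Thm. 19.4).
No definitions.
-/

-- layout-mandated namespace `Summit.<Summit>.<Problem>.…` with Summit = Problem (single-conjunct summit)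
set_option linter.dupNamespace false

open IsLocalRing
open Literature.AlgebraicGeometry.Resolution

namespace Summit.ResolutionOfSingularities.ResolutionOfSingularities.Theorems.SwitchingDichotomy

namespace LogFinal

variable {k K : Type*} [Field k] [Field K] [Algebra k K]

/-- The local ring at the centre of an affine model is a model. [folklore] -/
theorem isFractionRing_locAtCentre (O : ValuationSubring K) (A : Subalgebra k K)
    (hA : IsFractionRing A K) : IsFractionRing (locAtCentre A.toSubring O) K := by
  refine IsFractionRing.of_field (locAtCentre A.toSubring O) K fun z => ?_
  obtain ⟨a, b, -, rfl⟩ := IsFractionRing.div_surjective (A := A) z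
  exact ⟨⟨a, le_locAtCentre _ O a.2⟩, ⟨b, le_locAtCentre _ O b.2⟩, rfl⟩

/-- **L1 · Radicand exchange.** If some finitely generated `A ⊇ A₀` inside `O` with `Frac A = K` is
regular at the centre of `O`, and `t ^ p ∈ A₀` with `0 < p`, then there is such a model containing `t`.
[cite: Matsumura1987, Thm. 19.4] -/
theorem radicandExchange (O : ValuationSubring K) (A₀ : Subalgebra k K) (t : K) {p : ℕ} (hp : 0 < p)
    (htp : t ^ p ∈ A₀)
    (hC : ∃ (A : Subalgebra k K) (h : A.toSubring ≤ O.toSubring), A₀ ≤ A ∧ A.FG ∧ IsFractionRing A K ∧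
      IsRegularLocalRing
        (Localization.AtPrime (Ideal.comap (Subring.inclusion h) (IsLocalRing.maximalIdeal O)))) :
    ∃ (A : Subalgebra k K) (h : A.toSubring ≤ O.toSubring), A₀ ≤ A ∧ t ∈ A ∧ A.FG ∧ IsFractionRing A K ∧
      IsRegularLocalRing
        (Localization.AtPrime (Ideal.comap (Subring.inclusion h) (IsLocalRing.maximalIdeal O))) := by
  classical
  obtain ⟨A, hA, hle, hfg, hfr, hreg⟩ := hC
  -- the local ring at the centre, inside `K`: regular, hence integrally closed in `K = Frac`
  set L := locAtCentre A.toSubring O with hL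
  have hLO : L ≤ O.toSubring := locAtCentre_le hA
  haveI hregL : IsRegularLocalRing L := (isRegularLocalRing_locAtCentre_iff hA).mpr hreg
  haveI : IsFractionRing L K := isFractionRing_locAtCentre O A hfr
  haveI : IsIntegrallyClosedIn L K := isIntegrallyClosedIn_of_isRegularLocalRing L
  -- `t ∈ L`
  have htA : t ^ p ∈ L := le_locAtCentre _ O (hle htp)
  have htL : t ∈ L := by
    obtain ⟨y, hy⟩ := IsIntegrallyClosedIn.exists_algebraMap_eq_of_isIntegral_pow (R := L) (A := K) hp
      (IsIntegrallyClosedIn.isIntegral_iff.mpr ⟨⟨t ^ p, htA⟩, rfl⟩)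
    rw [← hy]
    exact y.2
  -- the new model `A' = A[t]`
  obtain ⟨S, hS⟩ := hfg
  let A' : Subalgebra k K := Algebra.adjoin k (insert t (S : Set K))
  have hAA' : A ≤ A' := by
    rw [← hS]
    exact Algebra.adjoin_mono (Set.subset_insert _ _)
  have htA' : t ∈ A' := Algebra.subset_adjoin (Set.mem_insert _ _)
  -- `A' ⊆ L`
  let L' : Subalgebra k K :=
    { L.toSubsemiring with
      algebraMap_mem' := fun c => le_locAtCentre _ O (A.algebraMap_mem c) }
  have hA'L : A' ≤ L' := by
    refine Algebra.adjoin_le ?_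
    rintro z (rfl | hz)
    · exact htL
    · exact le_locAtCentre _ O (hS ▸ Algebra.subset_adjoin hz : z ∈ A)
  have hA'L' : A'.toSubring ≤ L := fun z hz => hA'L hz
  have hA'O : A'.toSubring ≤ O.toSubring := hA'L'.trans hLO
  -- same local ring at the centre
  have hloc : locAtCentre A'.toSubring O = L := by
    apply le_antisymm
    · calc locAtCentre A'.toSubring O ≤ locAtCentre L O := locAtCentre_mono O hA'L'
        _ = L := locAtCentre_locAtCentre _ O
    · exact locAtCentre_mono O (fun z hz => hAA' hz)
  haveI := hfr
  refine ⟨A', hA'O, hle.trans hAA', htA', ⟨insert t S, by rw [Finset.coe_insert]⟩,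
    isFractionRing_subalgebra_of_le A A' hAA', ?_⟩
  exact (isRegularLocalRing_locAtCentre_iff hA'O).mp (hloc ▸ hregL)

/-- **L1, card form** (`RadicandExchange p` of `Sketch-idea-2b.lean` with `Concl` inlined): an exit for ANY
radicand `t₂` is an exit for `t`. [cite: Matsumura1987, Thm. 19.4] -/
theorem radicandExchange' (O : ValuationSubring K) (A₀ : Subalgebra k K) (t t₂ : K) {p : ℕ} (hp : 0 < p)
    (h₀ : A₀.toSubring ≤ O.toSubring) (htp : t ^ p ∈ A₀)
    (hC : ∃ (A : Subalgebra k K) (h : A.toSubring ≤ O.toSubring), A₀ ≤ A ∧ t₂ ∈ A ∧ A.FG ∧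
      IsFractionRing A K ∧ IsRegularLocalRing
        (Localization.AtPrime (Ideal.comap (Subring.inclusion h) (IsLocalRing.maximalIdeal O)))) :
    ∃ (A : Subalgebra k K) (h : A.toSubring ≤ O.toSubring), A₀ ≤ A ∧ t ∈ A ∧ A.FG ∧ IsFractionRing A K ∧
      IsRegularLocalRing
        (Localization.AtPrime (Ideal.comap (Subring.inclusion h) (IsLocalRing.maximalIdeal O))) := by
  have _ := h₀
  obtain ⟨A, h, hle, -, hfg, hfr, hreg⟩ := hC
  exact radicandExchange O A₀ t hp htp ⟨A, h, hle, hfg, hfr, hreg⟩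

end LogFinal

end Summit.ResolutionOfSingularities.ResolutionOfSingularities.Theorems.SwitchingDichotomy
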